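import Summits.AtomisticToContinuum.Crystallization.Theorems.ChartedZeroExcessLayeredLatticeLiouvilleZZZYRCN

/-!
# Charted zero-excess layered-lattice Liouville — ZZZYRCW: the full-range cluster certificate with a WORD-INDEXED tail price (edition 3a of D⁗)

Cell `decomp-a2c`, lens 2 «structural dichotomy (special | generic)», generation 99.  D⁗ (ZZZYRC, (243)) glues
`(K♯) ∧ (NL♯) ∧ (TL♯) ∧ (PF♯) ∧ (JF♯) ⇒ (SP♯)` with ONE tail price `τ : ℝ` shared by every admissible word: (TL♯) `TailBoundP … ϱ τ γT` books the
pairs beyond the stretch window `ϱ` as `2τ·N₁`, and (JF♯) closes with `2(κ₁ + τ) ≤ μ·cK − ν`.  The desk book TAIL99 (lens-2 g99, bus FINDING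
2026-09-04T11:44Z; files `g99/desk/TAIL99*.txt`, `TAUOPT99.txt`) prices that constant honestly: with `a₋(r) = (7r⁻⁸ − 13r⁻¹⁴)₊` the radial softening of a
pair of length `r > 1.1087`, contact-path routing gives `τ(ϱ; a) ≈ C·ϱ⁻³·a⁻⁵` on a word of in-plane scale `a`, `C = 2.6 – 2.9` for ideal far gap
heights (`3.7 / 4.9` when the far gaps are only known to the contact-ratio / clean window), i.e. `τ(4; a) = 0.034 … 0.058 … 0.125` at
`a = 1.0442 … 0.9375 … 0.81`; and NO proof in the scalar shape «`− 2τ·N₁`» can go below the plane-wave floor `τ_opt(4; a) = 0.022 / 0.026 / 0.036`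
(`a = 1.0442 / 1 / 0.9375`), `τ_opt(5; a) = 0.011 / 0.012 / 0.017`.  Two consequences are typed here, the third (the tail absorbed INSIDE the per-centre
certificate as radial debits on in-range pairs, «TAIL-DEBIT») in the sequel ZZZYRCD:

* a single `τ` for all admissible words is the wrong shape — the price varies `×3.6` with the scale `a` across the clean window and the in-plane
  lattice `(gen₁ L, gen₂ L)` of a layered word is GLOBAL (every cluster of the word knows it): **(TL♯-W) `TailBoundW … ϱ τf γT`** and
  **(JF♯-W) `ClusterCertificateFullW … cK τg κ₁`** carry tail prices `τf, τg : (E3 ≃L[ℝ] E3) → (ℤ → E3) → ℝ` INDEXED BY THE WORD, and the glue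
  asks only `τf ≤ τg` on admissible words — the prover of (TL♯-W) supplies any explicit majorant table `τf`, the K-file of (JF♯-W) closes each box
  with any table `τg` above it; edition 2 is the constant case (`tailBoundW_of_tailBoundP`, `clusterCertificateFullW_of_clusterCertificateFullP`);
* the glue `(RI♯) ∧ (K♯) ∧ (TL♯-W) ∧ (PF♯) ∧ (JF♯-W) ∧ (CZ♯) ⇒ (U♯)` (`uniformEquilStabilityAt_of_clusterCertificateFullW`, (NL♯) discharged by
  ZZZYRCN's `nullLagrangianP`) is D⁗'s, word by word.

No numeric record instance is given: by the critic's rule (r1758/r1768) record dials come from PROVED tail tables only, and TAIL99 shows the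
CLOSURE-53 dial sheet's `τ` column (1/60, 1/85, 1/115) is not attainable in this currency.  Def + theorem file (2 defs, 6 theorems); imports ZZZYRCN
only; no instance / notation / option; 0 sorry. [g99]
-/

open scoped BigOperators InnerProductSpace RealInnerProductSpace

namespace Summit.AtomisticToContinuum.Crystallization.Theorems.ChartedZeroExcessLayeredLatticeLiouville

open Summit.AtomisticToContinuum.Crystallization.Theorems.ChartedPlanarOrderRigidityDoor (E3)

/-- **(TL♯-W) «TailBoundW s Λ c₀ ℓ₀ r₁ ϱ τf γT»** — THE TAIL BEYOND THE RANGE WITH A WORD-INDEXED PRICE (support · ATTACKABLE-M): on every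
admissible word `(L, w')`, for every finitely supported `φ` and every value `E` of the ordered-pair harmonic form,
`rangeHessSum ϱ − 2·τf L w'·N₁ − 2γT·nnFormZ ≤ E`.  The intended `τf` is an explicit step table in the word's in-plane scale
`‖L.symm‖⁻¹` and gap-height floor (TAIL99: `≈ C·ϱ⁻³·a⁻⁵`); any pointwise LARGER table also satisfies it (`tailBoundW_mono`).  Proof route (memo
NODE-g99 §1): termwise `⟨v, forceConst e v⟩ ≥ −a₋(‖e‖)·‖v‖²` beyond `ϱ ≥ 1.22` (B `forceConst_apply`), summability and the split
`E = rangeHessSum ϱ + Σ_far` (UY `norm_layeredKernel_le`), path Cauchy–Schwarz along layer-monotone climbs + in-plane geodesics with the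
per-edge load majorised class by class (Scheme A), a finite certified class sum plus an analytic remainder.  WEAKER than (U♯): a termwise
inequality.  Why it might fail: only a mis-set table (the scalar-currency floor `τ_opt` bounds every admissible table from below). [g99] -/
def TailBoundW (s Λ c₀ ℓ₀ r₁ ϱ : ℝ) (τf : (E3 ≃L[ℝ] E3) → (ℤ → E3) → ℝ) (γT : ℝ) : Prop :=
  ∀ a : ℝ, 0 < a → ∀ (L : E3 ≃L[ℝ] E3) (w' : ℤ → E3), IsAdmissibleWord a s Λ c₀ ℓ₀ L w' →
    ∀ φ : Cell 2 → ℤ → E3, HasFiniteSupport φ → ∀ E : ℝ,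
      HasSum (fun x : (Cell 2 × ℤ) × (Cell 2 × ℤ) =>
        ⟪φ x.2.1 x.2.2 - φ x.1.1 x.1.2,
          layeredKernel (gen₁ L) (gen₂ L) w' (x.2.1 - x.1.1) x.1.2 x.2.2 (φ x.2.1 x.2.2 - φ x.1.1 x.1.2)⟫) E →
      rangeHessSum ϱ (gen₁ L) (gen₂ L) w' φ - 2 * τf L w' * contactForm r₁ (gen₁ L) (gen₂ L) w' φ - 2 * γT * nnFormZ φ ≤ E

/-- ★ **(JF♯-W) «ClusterCertificateFullW s Λ c₀ ℓ₀ r₁ ϱ R cK τg κ₁»** — D⁗'s FULL-RANGE PRESTRESSED CLUSTER CERTIFICATE WITH A WORD-INDEXED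
CLOSURE (crux, rank 3 · SPECIAL · INSTRUMENTED): for every admissible word there are `μ ≥ 0`, `ν`, a short layer step and null-Lagrangian tables
with `2(κ₁ + τg L w') ≤ μ·cK − ν` and `0 ≤ clusterFormFull …` at every centre.  The K-file reads `τg` at each box from the tail table of record
(sup over the box); any pointwise SMALLER table is implied (`clusterCertificateFullW_anti`).  Why it might fail: as (JF♯) — the thin tensile
corner (JS53: `max_μ(μ·cK − ν) = 0.0504` at `cK = 1/10`, `ϱ = 49/20`) against `2(κ₁ + τg)`; TAIL99 shows the scalar currency cannot close there at
`ϱ ≤ 5` (floor `τ_opt`), which is why the sequel moves the tail inside the form. [g99] -/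
def ClusterCertificateFullW (s Λ c₀ ℓ₀ r₁ ϱ R cK : ℝ) (τg : (E3 ≃L[ℝ] E3) → (ℤ → E3) → ℝ) (κ₁ : ℝ) : Prop :=
  ∀ a : ℝ, 0 < a → ∀ (L : E3 ≃L[ℝ] E3) (w' : ℤ → E3), IsAdmissibleWord a s Λ c₀ ℓ₀ L w' →
    ∃ (μ ν : ℝ) (d : ℤ → Cell 2) (Cpar : ℤ → Fin 3 → Fin 3 → (E3 →L[ℝ] E3)) (Cperp : Fin 3 → Fin 3 → (E3 →L[ℝ] E3)),
      0 ≤ μ ∧ IsShortStep r₁ (gen₁ L) (gen₂ L) w' d ∧ 2 * (κ₁ + τg L w') ≤ μ * cK - ν ∧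
      ∀ (c : Cell 2 × ℤ) (φ : Cell 2 → ℤ → E3), HasFiniteSupport φ →
        0 ≤ clusterFormFull r₁ ϱ R μ ν d Cpar Cperp (gen₁ L) (gen₂ L) w' c φ

/-- edition 2 is the constant case of (TL♯-W). [g99] -/
theorem tailBoundW_of_tailBoundP {s Λ c₀ ℓ₀ r₁ ϱ τ γT : ℝ} (h : TailBoundP s Λ c₀ ℓ₀ r₁ ϱ τ γT) :
    TailBoundW s Λ c₀ ℓ₀ r₁ ϱ (fun _ _ => τ) γT :=
  fun a ha L w' hadm φ hφ E hE => h a ha L w' hadm φ hφ E hE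

/-- edition 2 is the constant case of (JF♯-W). [g99] -/
theorem clusterCertificateFullW_of_clusterCertificateFullP {s Λ c₀ ℓ₀ r₁ ϱ R cK τ κ₁ : ℝ} (h : ClusterCertificateFullP s Λ c₀ ℓ₀ r₁ ϱ R cK τ κ₁) :
    ClusterCertificateFullW s Λ c₀ ℓ₀ r₁ ϱ R cK (fun _ _ => τ) κ₁ :=
  fun a ha L w' hadm => h a ha L w' hadm

/-- (TL♯-W) is MONOTONE in the table: a larger price is a weaker claim (`N₁ ≥ 0`). [g99] -/
theorem tailBoundW_mono {s Λ c₀ ℓ₀ r₁ ϱ γT : ℝ} {τf τg : (E3 ≃L[ℝ] E3) → (ℤ → E3) → ℝ} (h : TailBoundW s Λ c₀ ℓ₀ r₁ ϱ τf γT)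
    (hle : ∀ a : ℝ, 0 < a → ∀ (L : E3 ≃L[ℝ] E3) (w' : ℤ → E3), IsAdmissibleWord a s Λ c₀ ℓ₀ L w' → τf L w' ≤ τg L w') :
    TailBoundW s Λ c₀ ℓ₀ r₁ ϱ τg γT := by
  intro a ha L w' hadm φ hφ E hE
  have h1 := h a ha L w' hadm φ hφ E hE
  have hN : 0 ≤ contactForm r₁ (gen₁ L) (gen₂ L) w' φ := contactForm_nonneg _ _ _ _ _
  have h2 : 2 * τf L w' * contactForm r₁ (gen₁ L) (gen₂ L) w' φ ≤ 2 * τg L w' * contactForm r₁ (gen₁ L) (gen₂ L) w' φ :=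
    mul_le_mul_of_nonneg_right (by linarith [hle a ha L w' hadm]) hN
  linarith

/-- (JF♯-W) is ANTITONE in the table: a certificate closing against a larger price closes against a smaller one. [g99] -/
theorem clusterCertificateFullW_anti {s Λ c₀ ℓ₀ r₁ ϱ R cK κ₁ : ℝ} {τf τg : (E3 ≃L[ℝ] E3) → (ℤ → E3) → ℝ}
    (h : ClusterCertificateFullW s Λ c₀ ℓ₀ r₁ ϱ R cK τg κ₁)
    (hle : ∀ a : ℝ, 0 < a → ∀ (L : E3 ≃L[ℝ] E3) (w' : ℤ → E3), IsAdmissibleWord a s Λ c₀ ℓ₀ L w' → τf L w' ≤ τg L w') :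
    ClusterCertificateFullW s Λ c₀ ℓ₀ r₁ ϱ R cK τf κ₁ := by
  intro a ha L w' hadm
  obtain ⟨μ, ν, d, Cpar, Cperp, hμ, hd, hc, hcl⟩ := h a ha L w' hadm
  exact ⟨μ, ν, d, Cpar, Cperp, hμ, hd, by linarith [hle a ha L w' hadm], hcl⟩

/-- ★★ **GLUE «FullRangeClusterCertificateW» (PROVED): (K♯) ∧ (NL♯) ∧ (TL♯-W)(τf) ∧ (PF♯) ∧ (JF♯-W)(τg) ∧ (τf ≤ τg on admissible words) ⇒ (SP♯)**
for every window list — D⁗'s `signedShellBudgetP_of_clusterCertificateFull` word by word, the tail price read off the word. [g99] -/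
theorem signedShellBudgetP_of_clusterCertificateFullW {s Λ c₀ ℓ₀ r₁ ϱ R cK κ₁ γT : ℝ} {τf τg : (E3 ≃L[ℝ] E3) → (ℤ → E3) → ℝ} {n : ℕ} {ρ C : ℕ → ℝ}
    (hK : UniformContactKornP s Λ c₀ ℓ₀ r₁ cK) (hNL : NullLagrangianP) (hFS : TailBoundW s Λ c₀ ℓ₀ r₁ ϱ τf γT)
    (hPU : PartitionIdentityFullP s Λ c₀ ℓ₀ r₁ ϱ R) (hJC : ClusterCertificateFullW s Λ c₀ ℓ₀ r₁ ϱ R cK τg κ₁)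
    (hle : ∀ a : ℝ, 0 < a → ∀ (L : E3 ≃L[ℝ] E3) (w' : ℤ → E3), IsAdmissibleWord a s Λ c₀ ℓ₀ L w' → τf L w' ≤ τg L w') :
    SignedShellBudgetP s Λ c₀ ℓ₀ r₁ cK κ₁ γT n ρ C := by
  have hFS' : TailBoundW s Λ c₀ ℓ₀ r₁ ϱ τg γT := tailBoundW_mono hFS hle
  intro a ha
  refine ⟨0, κ₁, fun _ => 0, fun _ => le_rfl, ?_, ?_, ?_⟩
  · simp
  · simp
  intro L w' hadm φ hφ E hE
  obtain ⟨μ, ν, d, Cpar, Cperp, hμ, hd, hc, hcl⟩ := hJC a ha L w' hadm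
  have h1 := hFS' a ha L w' hadm φ hφ E hE
  have h2 := hPU a ha L w' hadm φ hφ μ ν d Cpar Cperp hd
  have h0 : nullTotal d Cpar Cperp φ = 0 := hNL d Cpar Cperp φ hφ
  have hcert' : 0 ≤ rangeHessSum ϱ (gen₁ L) (gen₂ L) w' φ
      - μ * stretchForm 0 r₁ (gen₁ L) (gen₂ L) w' φ + ν * contactForm r₁ (gen₁ L) (gen₂ L) w' φ + nullTotal d Cpar Cperp φ :=
    HasSum.nonneg (fun c => hcl c φ hφ) h2
  have hcert : 0 ≤ rangeHessSum ϱ (gen₁ L) (gen₂ L) w' φ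
      - μ * stretchForm 0 r₁ (gen₁ L) (gen₂ L) w' φ + ν * contactForm r₁ (gen₁ L) (gen₂ L) w' φ := by linarith
  obtain ⟨hK1, _⟩ := hK a ha L w' hadm φ hφ
  have hN : 0 ≤ contactForm r₁ (gen₁ L) (gen₂ L) w' φ := contactForm_nonneg _ _ _ _ _
  have hmain := certificateFull_arith h1 hcert hK1 hN hμ hc
  simpa using hmain

/-- ★★ **THE DOOR WITH A WORD-INDEXED TAIL (PROVED): (RI♯) ∧ (K♯) ∧ (TL♯-W)(τf) ∧ (PF♯) ∧ (JF♯-W)(τg) ∧ (τf ≤ τg) ∧ (CZ♯) ⇒ (U♯)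
`UniformEquilStabilityAt s Λ κ₀ c₀`** for every `κ₀ ≤ κ₁·cZ − γT`, `0 ≤ κ₁`; (NL♯) is ZZZYRCN's theorem `nullLagrangianP`. [g99] -/
theorem uniformEquilStabilityAt_of_clusterCertificateFullW {s Λ c₀ ℓ₀ r₁ ϱ R cK cZ κ₁ κ₀ γT : ℝ} {τf τg : (E3 ≃L[ℝ] E3) → (ℤ → E3) → ℝ}
    (h0 : 0 ≤ κ₁) (hκ : κ₀ ≤ κ₁ * cZ - γT) (hRI : UniformReindexP s Λ c₀ ℓ₀) (hK : UniformContactKornP s Λ c₀ ℓ₀ r₁ cK)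
    (hFS : TailBoundW s Λ c₀ ℓ₀ r₁ ϱ τf γT) (hPU : PartitionIdentityFullP s Λ c₀ ℓ₀ r₁ ϱ R) (hJC : ClusterCertificateFullW s Λ c₀ ℓ₀ r₁ ϱ R cK τg κ₁)
    (hle : ∀ a : ℝ, 0 < a → ∀ (L : E3 ≃L[ℝ] E3) (w' : ℤ → E3), IsAdmissibleWord a s Λ c₀ ℓ₀ L w' → τf L w' ≤ τg L w')
    (hCZ : IndexCurrencyP s Λ c₀ ℓ₀ r₁ cZ) : UniformEquilStabilityAt s Λ κ₀ c₀ :=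
  uniformEquilStabilityAt_of_rigiditySplit (n := 0) (ρ := fun _ => 0) (C := fun _ => 0) h0 hκ hRI hK (shellStretchDominationP_zero _ _ _ _ _ _ _)
    (signedShellBudgetP_of_clusterCertificateFullW hK nullLagrangianP hFS hPU hJC hle) hCZ

end Summit.AtomisticToContinuum.Crystallization.Theorems.ChartedZeroExcessLayeredLatticeLiouville
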